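import Mathlib

/-!
# Determinant of a web spanned by four rank-one 3×3 matrices (Cauchy–Binet normal form)

For scalars `w₀ … w₃` and vectors `v₀ … v₃ ∈ R³` (any commutative ring),
`det (∑ i, wᵢ • vᵢ vᵢᵀ) = ∑ i, (∏_{j ≠ i} wⱼ) · det(V₍₋ᵢ₎)²`, where `V₍₋ᵢ₎` is the 3×3 matrix whose columns are
the three vectors other than `vᵢ` — the `3 × 4` case of the Cauchy–Binet formula for `V · diag(w) · Vᵀ`.
Use (cell `val-V1-extremal`, format (3,4) of the `MatrixDescartes` census; eng-4 note CAYLEY-NORMALFORM-34):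
a real symmetric 3×3 pencil `∑ₗ t^{dₗ} Sₗ` whose web `span{Sₗ}` is spanned by four real rank-one matrices
`εᵢ vᵢvᵢᵀ` has `det = ∑ᵢ λᵢ ∏_{j≠i} ℓⱼ(t)` with `ℓᵢ` the pencil path in node coordinates (four fewnomials on
the common support) and `sign λᵢ = (∏ε)·εᵢ`: the weight pattern is the node inertia pattern; all three certified
(3,4) rows of record are of this form with alternating inertia.
Honest framing: an algebraic identity (design/structure template, kernel-checked by `ring`); nothing here bears on
`MatrixDescartes` (stmt-ValiantsHypothesis-18050) for or against; VP ≠ VNP is not proved.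
-/

-- `Summit.ValiantsHypothesis.ValiantsHypothesis.…` repeats a component by the D-0017 layout (single-conjunct summit).
set_option linter.dupNamespace false

namespace Summit.ValiantsHypothesis.ValiantsHypothesis.Theorems.LacunarySymmetroidRankOneWeb

open Matrix

/-- **Cauchy–Binet normal form for a four-term rank-one web (3×3).** For `w : Fin 4 → R`, `v : Fin 4 → Fin 3 → R`:
`det (w₀ v₀v₀ᵀ + w₁ v₁v₁ᵀ + w₂ v₂v₂ᵀ + w₃ v₃v₃ᵀ) = w₁w₂w₃·det[v₁ v₂ v₃]² + w₀w₂w₃·det[v₀ v₂ v₃]² + w₀w₁w₃·det[v₀ v₁ v₃]²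
 + w₀w₁w₂·det[v₀ v₁ v₂]²`, where `det[v_a v_b v_c]` is the determinant of the matrix with those columns
(`Matrix.of fun r c => v (![a,b,c] c) r`). [folklore: Cauchy–Binet] -/
theorem det_sum_four_smul_vecMulVec {R : Type*} [CommRing R] (w : Fin 4 → R) (v : Fin 4 → Fin 3 → R) :
    (w 0 • Matrix.vecMulVec (v 0) (v 0) + w 1 • Matrix.vecMulVec (v 1) (v 1)
      + w 2 • Matrix.vecMulVec (v 2) (v 2) + w 3 • Matrix.vecMulVec (v 3) (v 3)).det
      = w 1 * w 2 * w 3 * (Matrix.of fun r c => v ((![1, 2, 3] : Fin 3 → Fin 4) c) r).det ^ 2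
        + w 0 * w 2 * w 3 * (Matrix.of fun r c => v ((![0, 2, 3] : Fin 3 → Fin 4) c) r).det ^ 2
        + w 0 * w 1 * w 3 * (Matrix.of fun r c => v ((![0, 1, 3] : Fin 3 → Fin 4) c) r).det ^ 2
        + w 0 * w 1 * w 2 * (Matrix.of fun r c => v ((![0, 1, 2] : Fin 3 → Fin 4) c) r).det ^ 2 := by
  simp only [Matrix.det_fin_three, Matrix.add_apply, Matrix.smul_apply, Matrix.vecMulVec_apply,
    Matrix.of_apply, smul_eq_mul, Matrix.cons_val_zero, Matrix.cons_val_one, Matrix.cons_val]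
  ring

/-- **Corollary (the `e₃` form).** Taking the vectors to be the three coordinate vectors and the all-ones vector,
`det (diag(z₁,z₂,z₃) + z₀·𝟙𝟙ᵀ) = z₁z₂z₃ + z₀(z₂z₃ + z₁z₃ + z₁z₂) = e₃(z₀,z₁,z₂,z₃)`: the explicit integer-symmetric
realisation `S_l = diag(ℓ₁[l],ℓ₂[l],ℓ₃[l]) + ℓ₀[l]·𝟙𝟙ᵀ` of a four-real-node (3,4) web used by the cell. [folklore] -/
theorem det_diagonal_add_smul_ones {R : Type*} [CommRing R] (z₀ z₁ z₂ z₃ : R) :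
    (!![z₁ + z₀, z₀, z₀; z₀, z₂ + z₀, z₀; z₀, z₀, z₃ + z₀] : Matrix (Fin 3) (Fin 3) R).det
      = z₁ * z₂ * z₃ + z₀ * (z₂ * z₃ + z₁ * z₃ + z₁ * z₂) := by
  simp only [Matrix.det_fin_three, Matrix.of_apply, Matrix.cons_val', Matrix.cons_val_zero, Matrix.cons_val_one,
    Matrix.cons_val, Matrix.empty_val', Matrix.cons_val_fin_one]
  ring

end Summit.ValiantsHypothesis.ValiantsHypothesis.Theorems.LacunarySymmetroidRankOneWeb
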